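import Literature.NumberTheory.EllipticCurves.Sprung2012.ColemanMapLambdaActionProofs
import Literature.NumberTheory.EllipticCurves.Sprung2012.SharpFlatSelmer
import HarnessLib

/-!
# TRIAGE r1 seat 1 (gen 6) — level-1 structure of Sprung's `♯/♭` theory at the cyclotomic prime
# `𝔭₁ = (Φ_p(1+T))`: `Ker Col♯` kills `ℤ[G₁·c₁]` (so level-1 points are `♯`-admissible), `Ker Col♭` kills
# `c₀`, and `Φ_p(1+T) ∣ v_n` for all `n ≥ 1` (the `♭` colour is invisible at level-1 characters).
# Kernel evidence for the Gen-6 addendum §G of `TRIAGE-r1-1.md` (stub S4b `stub_cyclotomicLowerRest` of the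
# PICKED line `chromatic-common-zeros`, per-pair consumption of x8's R5 table at the 15 cells with
# `L(E, χ₉, 1) = 0`).

crux stmt-BirchSwinnertonDyer-19875 `SprungLowerDivisibilityAtThree`; seat refuter-cruxtriage-…-r1-1 (g6, 2026-08-28).
Evidence only: NO idea verdict depends on this file; BSD / K1 / the X8 leaf / stub S4b are NOT proved here.

Context (x8 `ty3/data/r5/x8_r5_chromatic_n5_j299803.tsv`, columns `v3L_•_zeta3^m`): on all 15 census cells with an
exact level-1 cyclotomic zero (`Φ₃(1+T) ∣ θ₁`, i.e. `L(E,χ₉,1) = 0`: 2170o1, 5980e1, 6419b1, 13510l1, 58667i1,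
116032by1, 205406a1, 338272a1, 345100s1, 362752b1, 365540c1, 365792l1, 407968f1, 15686f1 (+ m = 2), 37a1 (m = 2))
the table gives `v₃(L♯(ζ₃−1)) ≥ 10⁹` (the exact zero) but `v₃(L♭(ζ₃−1)) ∈ {1, 3/2, 2}` FINITE-EXACT: the zero is
`♯`-ONLY, not common — including on the six cells tagged `coprime-off-cyc@n5` (13510l1, 58667i1, 205406a1,
338272a1, 345100s1, 365540c1), whose tag records only that the finite-level joint window test cannot separate
the `♭` valuation-½ pair from `ζ₃^{±1} − 1`. Hence stub S4b is VACUOUS at `𝔭₁` on every decided cell, via the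
landed CertDoor `ChromaticCommonZeros.stub_cyclotomicLowerRest_of_cert` — PROVIDED the kernel is handed a
certificate «`Φ₃(1+T) ∤ L♭`». §E below shows why that certificate is NOT a Birch-sum / twisted-`L`-value
statement (unlike «`Φ₃ ∤ L♯`» `⇔ L(E,χ₉,1) ≠ 0`): `Φ_p(1+T) ∣ v_n` for every `n ≥ 1`, so every Mazur–Tate element
reads `θ_n(ζ_p−1) = −u_n(ζ_p−1)·L♯(ζ_p−1)` and never sees `L♭(ζ_p−1)`; the certificate must be coefficient-level
(`c_j(L♭) mod p^{e_j}`, `j ≤ 4` at `p = 3` for a target valuation `≤ 2`), the technology of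
`PAdicLambdaCertificateProofs.order_toNat_eq_of_lagrangeSum`.

Content (tree conventions of `Sprung2012/ColemanMaps.lean`: a functional `z : E(K_∞·K_v) →+ ℤ_p` has
Coleman value `(L♯, L♭)` iff `ω_n ∣ P_{n,c_n}(z) + u_n L♯ + v_n L♭` for all `n`, `u = sharpPoly`,
`v = flatPoly`, `u_0 = 0, u_1 = 1, v_0 = 1, v_1 = 0`):

* `eq_zero_of_omega_dvd_coe` / `eq_zero_of_omega_dvd_sum` — a polynomial of degree `< pⁿ` (e.g. an
  orbit sum `∑_{j<pⁿ} a_j (1+T)ʲ`) divisible by `ω_n` in `Λ = ℤ_p⟦T⟧` vanishes (Weierstrass division by the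
  distinguished `ω_n`; tree `Sprung2012.omega_dvd_of_coe_dvd`, `Kato2004.IwasawaH1Exists.isDistinguishedAt_omega`);
* `evalOn_orbit_c_one_eq_zero_of_mem_colemanKer_sharp` — **`z ∈ Ker Col♯ ⇒ z(gʲ c₁) = 0` for all
  `j < p`**: level `1` of the Coleman characterisation reads `ω₁ ∣ P_{1,c₁}(z) + L♯`, so `L♯ = 0` forces
  `ω₁ ∣ P_{1,c₁}(z)`, a polynomial of degree `< p`; i.e. `Ker Col♯` annihilates the `G₁`-orbit
  (`ℤ_p[G₁]`-span) of the Honda point `c₁` — Sprung 2013 (Crelle 681, arXiv:1106.1936) Def. 3/Thm. 2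
  at level 1, image-free and `a_p`-free;
* `evalOn_c_zero_eq_zero_of_mem_colemanKer_flat` — **`z ∈ Ker Col♭ ⇒ z(c₀) = 0`** (level `0`:
  `T ∣ z(c₀) + L♭`);
* `localKummerOverOfEmb_orbitSpanOne_le_sharp` — the LOCAL-CONDITION form: every Kummer class
  `[x ⊗ p^{-k}]` with `x = pᵏQ` in the `ℤ`-span of `{gʲ c₁ : j < p}` lies in Sprung's `♯` condition
  `sharpFlatLocalKummerOverOfEmb … (Ker Col♯)` = `E♯_{∞,𝔭}` of Def. 7.9 (its divisibility clause holds
  because `z(x) = 0`); this is the in-tree hook for "level-1 points ⇒ classes in `Sel♯`";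
* `cyclotomic_comp_dvd_flatPoly` — **`Φ_p(1+T) ∣ v_n` for all `n ≥ 1`** (above).
With Honda generation `Ê(𝔪₁) = ℤ_p[G₁]c₁ + ℤ_p c₀` (Sprung2012 Thm. 2.2, tree `IsHondaSystem`, dual
form) the ♯-lemmas say: the level-1 trace-zero local points lie in the `♯` local condition (up to the finite
index handled by divisibility of `E ⊗ ℚ_p/ℤ_p`), hence a rank jump `rank E(ℚ(ζ₉)⁺) − rank E(ℚ) = 2k` forces
`length_{𝔭₁} X♯ ≥ k` — the NON-VACUOUS mechanism for S4b(a) at `𝔭₁` should a genuinely common level-1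
zero (`L♭(ζ₃−1) = 0`, a non-interpolated coincidence never certifiable by finite data) ever occur, and the
BSD-predicted structure (x8 R5 README §6: rank jump `≥ 2` in `ℚ(ζ₉)⁺` predicted on the 15 cells; not needed
for any per-pair closure). Levels `n ≥ 2` give no such one-colour statement when `a_p ≠ 0` (`u_2 = a_p`,
`v_2 = −Φ_p(1+T)`: two-term), consistent with Sprung 2013 p. 3.

`lean check`: rc 0, 0 warnings, 0 sorries; axioms {propext, Classical.choice, Quot.sound}.
-/

set_option autoImplicit false
set_option linter.dupNamespace false

noncomputable section

open Polynomial Literature.NumberTheory.EllipticCurves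
  Literature.NumberTheory.EllipticCurves.Sprung2017 Literature.NumberTheory.EllipticCurves.Sprung2012
  Literature.NumberTheory.EllipticCurves.Kobayashi2003 Literature.NumberTheory.GaloisRepresentations

universe u

namespace Summit.BirchSwinnertonDyer.BirchSwinnertonDyer.Cruxes.SprungLowerDivisibilityAtThree.TriageR11

namespace LevelOne

/-! ## §A Weierstrass: `ω_n ∣ r`, `deg r < pⁿ` ⇒ `r = 0` -/

section Algebra

variable {p : ℕ} [Fact p.Prime]

/-- `ω_n = (X+1)^{pⁿ} − 1 ∈ ℤ_p[X]` has `natDegree = pⁿ`. [folklore] -/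
theorem natDegree_omega (n : ℕ) : ((X + 1 : ℤ_[p][X]) ^ p ^ n - 1).natDegree = p ^ n := by
  have hp : p.Prime := Fact.out
  have h1 : (X + 1 : ℤ_[p][X]) = X + C 1 := by rw [C_1]
  have hpow : ((X + C 1 : ℤ_[p][X]) ^ p ^ n).natDegree = p ^ n := by
    rw [(monic_X_add_C 1).natDegree_pow, natDegree_X_add_C, mul_one]
  rw [h1, natDegree_sub_eq_left_of_natDegree_lt, hpow]
  rw [natDegree_one, hpow]
  exact pow_pos hp.pos n

/-- **A polynomial of degree `< pⁿ` divisible by `ω_n` in `Λ = ℤ_p⟦T⟧` is zero** (Weierstrass division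
by the distinguished polynomial `ω_n` of degree `pⁿ`: `ℤ_p[T]/(ω_n) ↪ Λ/(ω_n)`, then degrees).
[cite: Washington1997, Prop. 7.2] -/
theorem eq_zero_of_omega_dvd_coe {n : ℕ} {r : ℤ_[p][X]} (hr : r.degree < (p ^ n : ℕ))
    (h : toIwasawa p (cyclotomicOmega p n) ∣ (r : PowerSeries ℤ_[p])) : r = 0 := by
  rw [toIwasawa_cyclotomicOmega_eq_coe] at h
  have hdvd := omega_dvd_of_coe_dvd h
  refine eq_zero_of_dvd_of_degree_lt hdvd ?_
  rw [degree_eq_natDegree (Kato2004.IwasawaH1Exists.isDistinguishedAt_omega p n).monic.ne_zero, natDegree_omega]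
  exact hr

/-- **Orbit-sum form**: if `ω_n ∣ ∑_{j<pⁿ} a_j (1+T)ʲ` in `Λ`, then every `a_j = 0` (the `(1+T)ʲ`,
`j < pⁿ`, are a `ℤ_p`-basis of `ℤ_p[T]_{<pⁿ} ≅ Λ/(ω_n) = ℤ_p[G_n]`). [cite: Washington1997, Prop. 7.2] -/
theorem eq_zero_of_omega_dvd_sum {n : ℕ} (a : ℕ → ℤ_[p])
    (h : toIwasawa p (cyclotomicOmega p n) ∣
      ∑ j ∈ Finset.range (p ^ n), PowerSeries.C (a j) * (1 + PowerSeries.X) ^ j) :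
    ∀ j, j < p ^ n → a j = 0 := by
  -- `s = ∑ a_j Xʲ`, `taylor 1 s = ∑ a_j (X+1)ʲ`, whose image in `Λ` is the orbit sum
  set s : ℤ_[p][X] := ∑ j ∈ Finset.range (p ^ n), monomial j (a j) with hs
  have htaylor : taylor 1 s = ∑ j ∈ Finset.range (p ^ n), C (a j) * (X + 1) ^ j := by
    rw [hs, map_sum]
    refine Finset.sum_congr rfl fun j _ => ?_
    rw [taylor_monomial, C_1]
  have hcoe : ((taylor 1 s : ℤ_[p][X]) : PowerSeries ℤ_[p]) =
      ∑ j ∈ Finset.range (p ^ n), PowerSeries.C (a j) * (1 + PowerSeries.X) ^ j := by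
    rw [htaylor, ← coeToPowerSeries.ringHom_apply, map_sum]
    refine Finset.sum_congr rfl fun j _ => ?_
    rw [map_mul, map_pow, map_add, map_one, coeToPowerSeries.ringHom_apply,
      coeToPowerSeries.ringHom_apply, coe_C, coe_X, add_comm]
  rw [← hcoe] at h
  -- degree bound
  have hdeg_s : s.degree < (p ^ n : ℕ) := by
    rw [hs]
    refine lt_of_le_of_lt (degree_sum_le _ _) ?_
    refine (Finset.sup_lt_iff (WithBot.bot_lt_coe (p ^ n))).2 fun j hj => ?_
    have hjlt : j < p ^ n := Finset.mem_range.1 hj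
    have hcast : ((j : ℕ) : WithBot ℕ) < ((p ^ n : ℕ) : WithBot ℕ) := by
      rw [Nat.cast_withBot, Nat.cast_withBot]; exact WithBot.coe_lt_coe.2 hjlt
    exact lt_of_le_of_lt (degree_monomial_le j (a j)) hcast
  have hdeg : (taylor 1 s).degree < (p ^ n : ℕ) := by rwa [degree_taylor]
  have h0 : taylor 1 s = 0 := eq_zero_of_omega_dvd_coe hdeg h
  have hs0 : s = 0 := (taylor_eq_zero (r := 1) (f := s)).1 h0
  intro j hj
  have hcoeff : s.coeff j = a j := by
    rw [hs, finsetSum_coeff]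
    rw [Finset.sum_eq_single j]
    · exact coeff_monomial_same j (a j)
    · intro i _ hij
      rw [coeff_monomial, if_neg hij]
    · intro hj'
      exact absurd (Finset.mem_range.2 hj) hj'
  rw [← hcoeff, hs0, coeff_zero]

end Algebra

/-! ## §B/§C The annihilation lemmas -/

section Local

variable {K : Type u} [Field K] {p : ℕ} [Fact p.Prime] (κ : ZpExtension K p)
variable {E : Type u} [Field E] [Algebra K E] (ι : AlgebraicClosure K →ₐ[K] AlgebraicClosure E)
variable (W : WeierstrassCurve K)

/-- **`Ker Col♯` annihilates the `G₁`-orbit of the Honda point `c₁`**: if `z` has a Coleman value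
`(L♯, L♭)` with `L♯ = 0`, then `z(gʲ • c₁) = 0` for every `j < p` (level `1` of Def. 5.9/7.1:
`ω₁ ∣ P_{1,c₁}(z) + u₁ L♯ + v₁ L♭ = P_{1,c₁}(z) + L♯`, and `P_{1,c₁}(z)` is a polynomial of degree `< p`).
So the `ℤ_p[G₁]`-span of `c₁` — by Honda generation (Thm. 2.2) the level-1 formal points modulo
`ℤ_p c₀` — pairs to `0` with `Ker Col♯`: it lies in the `♯` local condition of Def. 7.9.
[cite: Sprung2012, Def. 7.1/7.2 (p. 1500) and Def. 7.9 (p. 1503)] -/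
theorem evalOn_orbit_c_one_eq_zero_of_mem_colemanKer_sharp {ap : ℤ} {g : Field.absoluteGaloisGroup E}
    {c : ℕ → localPoints W E} {z : localTowerPointsOfEmb κ ι W →+ ℤ_[p]}
    (hz : z ∈ colemanKer κ ι W ap g c Chroma.sharp) :
    ∀ j, j < p → evalOn W (localTowerPointsOfEmb κ ι W) z (g ^ j • c 1) = 0 := by
  obtain ⟨Ls, Lf, hCP, hL⟩ := hz
  rw [chromaticL_sharp] at hL
  subst hL
  have h1 := hCP 1
  rw [sharpPoly_one, flatPoly_one, map_one, map_zero, one_mul, zero_mul, add_zero, add_zero,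
    pairingSum_def] at h1
  have h := eq_zero_of_omega_dvd_sum (n := 1)
    (fun j => evalOn W (localTowerPointsOfEmb κ ι W) z (g ^ j • c 1)) h1
  intro j hj
  exact h j (by rwa [pow_one])

/-- **`Ker Col♭` annihilates the Honda point `c₀`**: if `z` has a Coleman value `(L♯, L♭)` with
`L♭ = 0`, then `z(c₀) = 0` (level `0`: `T ∣ z(c₀) + u₀ L♯ + v₀ L♭ = z(c₀) + L♭`). The `♭` colour sees
the level-0 points, the `♯` colour the level-1 orbit of `c₁` — Kobayashi's `E⁺ ∋` even / `E⁻ ∋` odd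
layers at `a_p = 0` (`Col♯ = Col⁻`, `Col♭ = Col⁺`). [cite: Sprung2012, Def. 7.1/7.2 (p. 1500) and Def. 7.9 (p. 1503)] -/
theorem evalOn_c_zero_eq_zero_of_mem_colemanKer_flat {ap : ℤ} {g : Field.absoluteGaloisGroup E}
    {c : ℕ → localPoints W E} {z : localTowerPointsOfEmb κ ι W →+ ℤ_[p]}
    (hz : z ∈ colemanKer κ ι W ap g c Chroma.flat) :
    evalOn W (localTowerPointsOfEmb κ ι W) z (c 0) = 0 := by
  obtain ⟨Ls, Lf, hCP, hL⟩ := hz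
  rw [chromaticL_flat] at hL
  subst hL
  have h0 := hCP 0
  rw [sharpPoly_zero, flatPoly_zero, map_zero, map_one, zero_mul, mul_zero, add_zero, add_zero,
    pairingSum_def] at h0
  have h := eq_zero_of_omega_dvd_sum (n := 0)
    (fun j => evalOn W (localTowerPointsOfEmb κ ι W) z (g ^ j • c 0)) h0 0 (by rw [pow_zero]; exact one_pos)
  simpa only [pow_zero, one_smul] using h

end Local

/-! ## §D The local-condition form: `ℤ[G₁·c₁] ⊗ p^{-k} ⊆ E♯_{∞,𝔭}` -/

section SharpCondition

variable {K : Type u} [Field K] {p : ℕ} [Fact p.Prime] (κ : ZpExtension K p)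
variable {E : Type u} [Field E] [Algebra K E] (ι : AlgebraicClosure K →ₐ[K] AlgebraicClosure E)
variable (W : WeierstrassCurve K)

/-- The `ℤ`-span of the `G₁`-orbit `{gʲ • c₁ : j < p}` of the level-1 Honda point (bookkeeping).
[cite: Sprung2012, Thm. 2.2 (p. 1487) (the `ℤ_p[G_n]`-span of `c_n`)] -/
def orbitSpanOne (g : Field.absoluteGaloisGroup E) (c : ℕ → localPoints W E) :
    AddSubgroup (localPoints W E) :=
  AddSubgroup.closure ((fun j : ℕ => g ^ j • c 1) '' Set.Iio p)

/-- The orbit span lies in `E(K_∞·K_v)` once `c₁` does. [cite: Sprung2012, Thm. 2.2 (p. 1487)] -/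
theorem orbitSpanOne_le (g : Field.absoluteGaloisGroup E) (c : ℕ → localPoints W E)
    (hc1 : c 1 ∈ localTowerPointsOfEmb κ ι W) :
    orbitSpanOne (p := p) W g c ≤ localTowerPointsOfEmb κ ι W := by
  refine (AddSubgroup.closure_le _).2 ?_
  rintro _ ⟨j, -, rfl⟩
  exact smul_mem_localTowerPointsOfEmb κ ι W _ hc1

/-- **`Ker Col♯` vanishes on the `ℤ`-span of the `G₁`-orbit of `c₁`.**
[cite: Sprung2012, Def. 7.1/7.2 (p. 1500) and Def. 7.9 (p. 1503)] -/
theorem apply_eq_zero_of_mem_orbitSpanOne {ap : ℤ} {g : Field.absoluteGaloisGroup E}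
    {c : ℕ → localPoints W E} {z : localTowerPointsOfEmb κ ι W →+ ℤ_[p]}
    (hz : z ∈ colemanKer κ ι W ap g c Chroma.sharp) (hc1 : c 1 ∈ localTowerPointsOfEmb κ ι W)
    {x : localPoints W E} (hx : x ∈ orbitSpanOne (p := p) W g c) :
    z ⟨x, orbitSpanOne_le κ ι W g c hc1 hx⟩ = 0 := by
  induction hx using AddSubgroup.closure_induction with
  | mem x hx' =>
    obtain ⟨j, hj, rfl⟩ := hx'
    have h := evalOn_orbit_c_one_eq_zero_of_mem_colemanKer_sharp κ ι W hz j hj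
    rwa [evalOn_of_mem W _ z (smul_mem_localTowerPointsOfEmb κ ι W _ hc1)] at h
  | zero => exact map_zero z
  | add x y hx hy ihx ihy =>
    have hxy : (⟨x + y, orbitSpanOne_le κ ι W g c hc1 (add_mem hx hy)⟩ : localTowerPointsOfEmb κ ι W) =
        ⟨x, orbitSpanOne_le κ ι W g c hc1 hx⟩ + ⟨y, orbitSpanOne_le κ ι W g c hc1 hy⟩ := rfl
    rw [hxy, map_add, ihx, ihy, add_zero]
  | neg x hx ih =>
    have hnx : (⟨-x, orbitSpanOne_le κ ι W g c hc1 (neg_mem hx)⟩ : localTowerPointsOfEmb κ ι W) =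
        -⟨x, orbitSpanOne_le κ ι W g c hc1 hx⟩ := rfl
    rw [hnx, map_neg, ih, neg_zero]

/-- **Kummer classes of the level-1 orbit span satisfy Sprung's `♯` local condition**: with
`A = ℤ[G₁·c₁]` (the span of `{gʲ c₁ : j < p}`), every class of `Kobayashi2003.localKummerOverOfEmb … A`
(`[x ⊗ p^{-k}]`, `x = pᵏQ ∈ A`) lies in `sharpFlatLocalKummerOverOfEmb … E(K_∞·K_v) (Ker Col♯)` — the
divisibility clause `pᵏ ∣ z(x)` holds as `z(x) = 0`. Combined with Honda generation (Thm. 2.2: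
`Ê(𝔪₁) = ℤ_p[G₁]c₁ + ℤ_p c₀`) this is "the trace-zero part of `E(k_{1,𝔭}) ⊗ ℚ_p/ℤ_p` lies in
`E♯_{∞,𝔭}`". [cite: Sprung2012, Def. 7.9 and Def. 7.11 (p. 1503)] -/
theorem localKummerOverOfEmb_orbitSpanOne_le_sharp {ap : ℤ} {g : Field.absoluteGaloisGroup E}
    {c : ℕ → localPoints W E} (hc1 : c 1 ∈ localTowerPointsOfEmb κ ι W) :
    localKummerOverOfEmb W p κ.kerSubgroup ι (orbitSpanOne (p := p) W g c) ≤
      sharpFlatLocalKummerOverOfEmb W p κ.kerSubgroup ι (localTowerPointsOfEmb κ ι W)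
        (colemanKer κ ι W ap g c Chroma.sharp) := by
  rintro x ⟨φ, Q, k, hc, hA, hτ⟩
  refine ⟨φ, Q, k, orbitSpanOne_le κ ι W g c hc1 hA, hc, fun z hz => ?_, hτ⟩
  rw [apply_eq_zero_of_mem_orbitSpanOne κ ι W hz hc1 hA]
  exact dvd_zero _

end SharpCondition

/-! ## §E The `♭` colour is invisible at level-1 characters: `Φ_p(1+T) ∣ v_n` for all `n ≥ 1` -/

section FlatInvisible

/-- **`Φ_p(1+T)` divides every `v_n = flatPoly ap p n`, `n ≥ 1`** (`v_1 = 0`, `v_2 = −Φ_p(1+T)`, and the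
recursion `v_{n+2} = a_p v_{n+1} − Φ_{p^{n+1}}(1+T) v_n` preserves the ideal). Consequence for a Sprung pair
(`θ_n ≡ −(u_n L♯ + v_n L♭) mod ω_n`): at the level-1 points `ζ_p^{i} − 1` EVERY Mazur–Tate element reads the `♯`
colour alone, `θ_n(ζ_p^i − 1) = −u_n(ζ_p^i − 1)·L♯(ζ_p^i − 1)` for all `n ≥ 1`; the value `L♭(ζ_p − 1)` is NOT an
interpolated (twisted-`L`-value) quantity. So a per-pair certificate «`Φ_p(1+T) ∤ L♭`» (needed by the CertDoor
`stub_cyclotomicLowerRest_of_cert` at `j = 1` on the cells with `L(E, χ_{p²}, 1) = 0`, where `Φ_p(1+T) ∣ L♯`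
genuinely) cannot be a Birch-sum non-vanishing; it has to be a coefficient-level `p`-adic certificate for `L♭`.
[cite: Sprung2017, §4 Cor. 4.4 (the recursion)] -/
theorem cyclotomic_comp_dvd_flatPoly_succ (ap : ℤ) (p : ℕ) :
    ∀ n : ℕ, (cyclotomic p ℤ).comp (X + 1) ∣ flatPoly ap p (n + 1)
  | 0 => by rw [flatPoly_one]; exact dvd_zero _
  | 1 => by
      rw [flatPoly_two, pow_one]
      exact (dvd_neg).2 (dvd_refl _)
  | n + 2 => by
      rw [show n + 2 + 1 = (n + 1) + 2 from rfl, flatPoly_add_two]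
      exact dvd_sub (dvd_mul_of_dvd_right (cyclotomic_comp_dvd_flatPoly_succ ap p (n + 1)) _)
        (dvd_mul_of_dvd_right (cyclotomic_comp_dvd_flatPoly_succ ap p n) _)

/-- `Φ_p(1+T) ∣ v_n` for `1 ≤ n` (restatement). [cite: Sprung2017, §4 Cor. 4.4 (the recursion)] -/
theorem cyclotomic_comp_dvd_flatPoly (ap : ℤ) (p : ℕ) {n : ℕ} (hn : 1 ≤ n) :
    (cyclotomic p ℤ).comp (X + 1) ∣ flatPoly ap p n := by
  obtain ⟨m, rfl⟩ := Nat.exists_eq_add_of_le' hn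
  exact cyclotomic_comp_dvd_flatPoly_succ ap p m

end FlatInvisible

end LevelOne

end Summit.BirchSwinnertonDyer.BirchSwinnertonDyer.Cruxes.SprungLowerDivisibilityAtThree.TriageR11

end
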